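import Summits.BirchSwinnertonDyer.BirchSwinnertonDyer.Theorems.KolyvaginDepthDoorDepthTableKuriharaRow571b1
import HarnessLib

/-!
# Route `KolyvaginDepthDoor`, crux `KolyvaginDepthSupplyKN` (stmt-BirchSwinnertonDyer-22820) —
# DEPTH TABLE v17, ROW `571b1` IN THE KURIHARA CURRENCY AT `p = 11` (`d_K = −7`; part 1 of 2 — the `p`-uniform shape, the point counts, the `p = 11` row): more admissible primes for the
# third closed curve, from the tree records `cert_571b1` = `(11, 2113·4159)`, `(13, 53·1847)` and `cert_27979d1` = `(11, 1013)`, `(13, 53)`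

Helper file of the lead prover of line `levelone` (kdd-p1 g21; `--supports stmt-BirchSwinnertonDyer-22820
--as helper`); it closes nothing and BSD is NOT proved by it.

Sequel of `KolyvaginDepthDoorDepthTableKuriharaRow571b1` (twist model `T₀ = [0,−1,1,−212,−1184] = 27979d1 = 571b1^{(−7)}`, the `p = 5` row).
`(−7/11) = 1` (split), `(−7/13) = −1` (inert): W. Zhang's ♠ supply serves both (`571` prime). Kernel side conditions: `a_11(E) = −3`,
`a_13(E) = −5` (good ordinary, non-anomalous), `ρ̄_{E,11}`, `ρ̄_{E,13}` onto (semistable + no-root witnesses `a_5 = −2` mod `11`,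
`a_3 = −2` mod `13`), levels `2113, 4159 ∈ 𝒫₁(E,11)`, `53, 1847 ∈ 𝒫₁(E,13)`, `1013 ∈ 𝒫₁(T₀,11)`, `53 ∈ 𝒫₁(T₀,13)` with cyclic `p`-parts
(`#Ẽ(𝔽₂₁₁₃) = 2068`, `#Ẽ(𝔽₄₁₅₉) = 4246`, `#Ẽ(𝔽₅₃) = 52`, `#Ẽ(𝔽₁₈₄₇) = 1872`, `#T̃₀(𝔽₁₀₁₃) = 1023`, `#T̃₀(𝔽₅₃) = 52`), `a_11(T₀) = −3`,
`a_13(T₀) = 5` (non-anomalous), Kodaira–Néron for `T₀` at `11`, `13` (exponents `6, 1`).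

* `cruxBody_of_kuriharaClaims_neg7_at` — the `p`-uniform row shape at `571b1` (as at `389a1`; the twist's Kodaira–Néron enters as a hypothesis).
* `cruxBody_of_kuriharaClaims_11_neg7` — the row at `11` (the `13` row is in the sequel file `…Row571b1Thirteen`).

CONDITIONAL on Kim 2026 Thm. 1.11, modularity, Mazur 1978 Cor. 4.1, W. Zhang 2014 L8.4 (1)/9.1 BY NAME and the record claims at the prime;
per curve; nothing class-wide (the open stub (S♭) is untouched); BSD is NOT proved by it.

References: [Kim2022StructureSelmer] Thm. 1.11; [WZhang2014] Lemma 8.4 (1), Thm. 9.1; [Mazur1978] Cor. 4.1, Prop. 6.3 (1); [Serre1972] §4.2,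
§5.4 Prop. 21; [CremonaAlgorithms1997] Table 1 (571b1); [SilvermanAEC2009] VII.3.1, VII.5.1.
-/

set_option linter.dupNamespace false

noncomputable section

open scoped Classical NumberField

namespace Summit.BirchSwinnertonDyer.BirchSwinnertonDyer.Theorems.KolyvaginDepthDoor

open Literature.NumberTheory.EllipticCurves Literature.NumberTheory.EllipticCurves.ModularForms
  WeierstrassCurve NumberField IsDedekindDomain
open Summit.BirchSwinnertonDyer.BirchSwinnertonDyer.Theorems
open Summit.BirchSwinnertonDyer.BirchSwinnertonDyer.Rank2Observatory
open Summit.BirchSwinnertonDyer.BirchSwinnertonDyer.Rank1Residual (IntModel.frobeniusTrace_eq)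
open Summit.BirchSwinnertonDyer.Rank1Residual.Supersingular (natCard_point_eq_of_countPoints countPoints_eq_of_fast)
open Summit.BirchSwinnertonDyer.Rank1Residual.Additive (card_torsion_le_of_intModel_of_card
  isKolyvaginPrime_of_intModel_of_card isKolyvaginProduct_mul)

namespace C571b1

/-! ## The `p`-uniform row shape at `571b1`, `d_K = −7` -/

/-- **THE v17 ROW SHAPE AT `571b1`, `d_K = −7`, UNIFORM IN THE PRIME.** `T₀ = [0, −1, 1, −212, −1184]` the minimal
model of `571b1^{(−7)}` (`minTwist7_smul_eq`). For ANY prime `p ≥ 5` with `p` good ordinary for `E`, `ρ̄_{E,p}` onto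
(the tower by Serre 1972 §4.2 Thm. 2, tree `serre_hasSurjectiveModNGaloisRep_pow_holds`), `a_p(E) ≢ 1 (mod p)` and `p ≠ 7` (`p ∤ d_K`);
ANY imaginary quadratic `K` with `d_K = −7`; an E-side Kurihara claim at a cyclic level `n` with `ν(n) ≤ 2` and a
twist-side claim on `T₀` at a cyclic level `m` with `ν(m) ≤ 2`, `a_p(T₀) ≢ 1`: the clause of `KolyvaginDepthSupplyKN`
holds at `W = 571b1` VERBATIM. Kodaira–Néron for `E` (`kodairaNeron_of_five_le`; for `T₀` a hypothesis `hTKN`), ♠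
(`spadeOne_of_five_le`), `2 ≤ rank E`, Heegner data are the lineage's kernel theorems. CONDITIONAL on Kim Thm. 1.11,
modularity, Mazur Cor. 4.1, W. Zhang L8.4 (1)/9.1 BY NAME and the two claims; per curve; BSD is not proved by it.
[cite: Kim2022StructureSelmer, Thm. 1.11 (PDF p. 8)] [cite: WZhang2014, Lemma 8.4 (1) (p. 236), Thm. 9.1 (p. 240)]
[cite: Serre1972, §4.2 Thm. 2] [cite: CremonaAlgorithms1997, Table 1 (571b1)] -/
theorem cruxBody_of_kuriharaClaims_neg7_at
    (hKim : Kim2022_card_selmerGroup_le_pow_of_kuriharaNumber_ne_zero)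
    (hnf : exists_isNewformOf) (hMaz : mazur_not_dvd_maninConstant_of_odd)
    (h84 : Literature.NumberTheory.EllipticCurves.WZhang2014_lemma84_exists_minimal_kolyvaginClass_one_selmerCard)
    (p : ℕ) [hp : Fact p.Prime] (h5 : 5 ≤ p) (hp7 : p ≠ 7)
    (hgood : haveI := isElliptic_c571b1; haveI := isGloballyMinimal_c571b1; ((⟨0, 1, 1, -4, 2⟩ : WeierstrassCurve ℤ).map (Int.castRingHom ℚ)).HasGoodReductionAtPrime p)
    (hord : haveI := isElliptic_c571b1; haveI := isGloballyMinimal_c571b1; ¬ (p : ℤ) ∣ ((⟨0, 1, 1, -4, 2⟩ : WeierstrassCurve ℤ).map (Int.castRingHom ℚ)).frobeniusTrace p)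
    (hsurj : ((⟨0, 1, 1, -4, 2⟩ : WeierstrassCurve ℤ).map (Int.castRingHom ℚ)).HasSurjectiveModNGaloisRep p)
    (hna : haveI := isElliptic_c571b1; haveI := isGloballyMinimal_c571b1; ¬ (p : ℤ) ∣ ((⟨0, 1, 1, -4, 2⟩ : WeierstrassCurve ℤ).map (Int.castRingHom ℚ)).frobeniusTrace p - 1)
    (K : Type) [Field K] [NumberField K] (hK : IsImaginaryQuadratic K) (hD : NumberField.discr K = -7)
    (n : ℕ) [NeZero n]
    (hn : haveI := isElliptic_c571b1; haveI := isGloballyMinimal_c571b1; IsCyclicKolyvaginLevel ((⟨0, 1, 1, -4, 2⟩ : WeierstrassCurve ℤ).map (Int.castRingHom ℚ)) p n)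
    (hν : n.primeFactors.card ≤ 2)
    (hδE : haveI := isElliptic_c571b1; haveI := isGloballyMinimal_c571b1;
      haveI : NeZero (((⟨0, 1, 1, -4, 2⟩ : WeierstrassCurve ℤ).map (Int.castRingHom ℚ)).conductorNorm ℤ) := neZero_conductorNorm_of_isElliptic _;
      ∀ (D : ModularParametrizationData ((⟨0, 1, 1, -4, 2⟩ : WeierstrassCurve ℤ).map (Int.castRingHom ℚ)) (((⟨0, 1, 1, -4, 2⟩ : WeierstrassCurve ℤ).map (Int.castRingHom ℚ)).conductorNorm ℤ)), ¬ (p : ℤ) ∣ D.maninConstant →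
        (∃ u : ℚ, ‖(u : ℚ_[p])‖ = 1 ∧ ((⟨0, 1, 1, -4, 2⟩ : WeierstrassCurve ℤ).map (Int.castRingHom ℚ)).realPeriodRat = u * plusPeriod D.f) →
        ∃ ψ : (ℓ : ℕ) → (ZMod ℓ)ˣ →* Multiplicative (ZMod p),
          (∀ ℓ ∈ n.primeFactors, Function.Surjective (ψ ℓ)) ∧ kuriharaNumber D.f p n ψ ≠ 0)
    (hTna : haveI := minTwist7_isGloballyMinimal;
      ¬ (p : ℤ) ∣ ((⟨0, -1, 1, -212, -1184⟩ : WeierstrassCurve ℤ).map (Int.castRingHom ℚ)).frobeniusTrace p - 1)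
    (hTKN : haveI := minTwist7_isElliptic; haveI := minTwist7_isGloballyMinimal;
      ∀ v : HeightOneSpectrum (𝓞 ℚ), ((⟨0, -1, 1, -212, -1184⟩ : WeierstrassCurve ℤ).map (Int.castRingHom ℚ)).HasMultiplicativeReductionAt v → ¬ p ∣ ((⟨0, -1, 1, -212, -1184⟩ : WeierstrassCurve ℤ).map (Int.castRingHom ℚ)).ordMinimalDiscriminant v)
    (m : ℕ) [NeZero m]
    (hm : haveI := minTwist7_isGloballyMinimal;
      IsCyclicKolyvaginLevel ((⟨0, -1, 1, -212, -1184⟩ : WeierstrassCurve ℤ).map (Int.castRingHom ℚ)) p m)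
    (hμ : m.primeFactors.card ≤ 2)
    (hδT : haveI := minTwist7_isElliptic; haveI := minTwist7_isGloballyMinimal;
      haveI : NeZero (((⟨0, -1, 1, -212, -1184⟩ : WeierstrassCurve ℤ).map (Int.castRingHom ℚ)).conductorNorm ℤ) :=
        neZero_conductorNorm_of_isElliptic _;
      ∀ (D : ModularParametrizationData ((⟨0, -1, 1, -212, -1184⟩ : WeierstrassCurve ℤ).map (Int.castRingHom ℚ))
          (((⟨0, -1, 1, -212, -1184⟩ : WeierstrassCurve ℤ).map (Int.castRingHom ℚ)).conductorNorm ℤ)),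
        ¬ (p : ℤ) ∣ D.maninConstant →
        (∃ u : ℚ, ‖(u : ℚ_[p])‖ = 1 ∧
          ((⟨0, -1, 1, -212, -1184⟩ : WeierstrassCurve ℤ).map (Int.castRingHom ℚ)).realPeriodRat = u * plusPeriod D.f) →
        ∃ ψ : (ℓ : ℕ) → (ZMod ℓ)ˣ →* Multiplicative (ZMod p),
          (∀ ℓ ∈ m.primeFactors, Function.Surjective (ψ ℓ)) ∧ kuriharaNumber D.f p m ψ ≠ 0) :
    haveI := isElliptic_c571b1; haveI := isGloballyMinimal_c571b1;
    ∃ (p : ℕ) (hp : Fact p.Prime), 5 ≤ p ∧ ((⟨0, 1, 1, -4, 2⟩ : WeierstrassCurve ℤ).map (Int.castRingHom ℚ)).HasGoodReductionAtPrime p ∧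
      ¬ (p : ℤ) ∣ ((⟨0, 1, 1, -4, 2⟩ : WeierstrassCurve ℤ).map (Int.castRingHom ℚ)).frobeniusTrace p ∧ (∀ n : ℕ, ((⟨0, 1, 1, -4, 2⟩ : WeierstrassCurve ℤ).map (Int.castRingHom ℚ)).HasSurjectiveModNGaloisRep (p ^ n : ℕ)) ∧
      (∀ v : HeightOneSpectrum (𝓞 ℚ), ((⟨0, 1, 1, -4, 2⟩ : WeierstrassCurve ℤ).map (Int.castRingHom ℚ)).HasMultiplicativeReductionAt v →
        ¬ p ∣ ((⟨0, 1, 1, -4, 2⟩ : WeierstrassCurve ℤ).map (Int.castRingHom ℚ)).ordMinimalDiscriminant v) ∧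
      ∃ (K : Type) (_ : Field K) (_ : NumberField K), IsImaginaryQuadratic K ∧
        NumberField.discr K ≠ -3 ∧ NumberField.discr K ≠ -4 ∧
        ∃ (_ : NeZero (((⟨0, 1, 1, -4, 2⟩ : WeierstrassCurve ℤ).map (Int.castRingHom ℚ)).conductorNorm ℤ)), SatisfiesHeegnerHypothesis (((⟨0, 1, 1, -4, 2⟩ : WeierstrassCurve ℤ).map (Int.castRingHom ℚ)).conductorNorm ℤ) K ∧
        ∃ (Dt : ModularParametrizationData ((⟨0, 1, 1, -4, 2⟩ : WeierstrassCurve ℤ).map (Int.castRingHom ℚ)) (((⟨0, 1, 1, -4, 2⟩ : WeierstrassCurve ℤ).map (Int.castRingHom ℚ)).conductorNorm ℤ)) (β : ℤ) (ι : K →+* ℂ) (n₁ : ℕ)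
          (d : KolyvaginHeegnerData Dt β ι n₁), Squarefree n₁ ∧
          (∀ q ∈ n₁.primeFactors, Zhang2014.IsKolyvaginPrime (((⟨0, 1, 1, -4, 2⟩ : WeierstrassCurve ℤ).map (Int.castRingHom ℚ)).conductorNorm ℤ) ((⟨0, 1, 1, -4, 2⟩ : WeierstrassCurve ℤ).map (Int.castRingHom ℚ)) K p q) ∧
          d.kolyvaginClass hp.out 1 ≠ 0 ∧
          (n₁.primeFactors.card + 1 ≤ ((⟨0, 1, 1, -4, 2⟩ : WeierstrassCurve ℤ).map (Int.castRingHom ℚ)).mordellWeilRank ∨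
            (n₁.primeFactors.card ≤ ((⟨0, 1, 1, -4, 2⟩ : WeierstrassCurve ℤ).map (Int.castRingHom ℚ)).mordellWeilRank ∧
              n₁.primeFactors.card + 1 ≤ (((⟨0, 1, 1, -4, 2⟩ : WeierstrassCurve ℤ).map (Int.castRingHom ℚ)).quadraticTwist (NumberField.discr K : ℚ)).mordellWeilRank)) := by
  haveI := isElliptic_c571b1
  haveI := isGloballyMinimal_c571b1
  haveI iNZ : NeZero (((⟨0, 1, 1, -4, 2⟩ : WeierstrassCurve ℤ).map (Int.castRingHom ℚ)).conductorNorm ℤ) := neZero_conductorNorm_of_isElliptic _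
  haveI := minTwist7_isElliptic
  haveI := minTwist7_isGloballyMinimal
  haveI iNZT : NeZero (((⟨0, -1, 1, -212, -1184⟩ : WeierstrassCurve ℤ).map (Int.castRingHom ℚ)).conductorNorm ℤ) :=
    neZero_conductorNorm_of_isElliptic _
  have hsp := spadeOne_of_five_le p h5
  have hS2 : ¬ Squarefree (((⟨0, 1, 1, -4, 2⟩ : WeierstrassCurve ℤ).map (Int.castRingHom ℚ)).conductorNorm ℤ) →
      (∃ (ℓ : ℕ) (_ : Fact ℓ.Prime), ((⟨0, 1, 1, -4, 2⟩ : WeierstrassCurve ℤ).map (Int.castRingHom ℚ)).HasMultiplicativeReductionAtPrime ℓ ∧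
          ¬ p ∣ padicValInt ℓ ((⟨0, 1, 1, -4, 2⟩ : WeierstrassCurve ℤ).map (Int.castRingHom ℚ)).minimalDiscriminantInt) ∧
        ∃ (ℓ₁ ℓ₂ : ℕ) (_ : Fact ℓ₁.Prime) (_ : Fact ℓ₂.Prime), ℓ₁ ≠ ℓ₂ ∧
          ((⟨0, 1, 1, -4, 2⟩ : WeierstrassCurve ℤ).map (Int.castRingHom ℚ)).HasMultiplicativeReductionAtPrime ℓ₁ ∧ ((⟨0, 1, 1, -4, 2⟩ : WeierstrassCurve ℤ).map (Int.castRingHom ℚ)).HasMultiplicativeReductionAtPrime ℓ₂ :=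
    fun hns ↦ absurd (((⟨0, 1, 1, -4, 2⟩ : WeierstrassCurve ℤ).map (Int.castRingHom ℚ)).isSemistable_iff_squarefree_conductorNorm.mp hsp.2) hns
  have hH : SatisfiesHeegnerHypothesis (((⟨0, 1, 1, -4, 2⟩ : WeierstrassCurve ℤ).map (Int.castRingHom ℚ)).conductorNorm ℤ) K :=
    satisfiesHeegnerHypothesis_conductorNorm_of_intModel intModel K hK.1 hD heegner_neg7
  have hD3 : NumberField.discr K ≠ -3 := by rw [hD]; norm_num
  have hD4 : NumberField.discr K ≠ -4 := by rw [hD]; norm_num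
  have hpD : ¬ ((p : ℤ) ∣ NumberField.discr K) := by
    rw [hD]
    intro h
    have h7 : (p : ℤ) ∣ (7 : ℤ) := by
      have h77 : (-7 : ℤ) = -(7 : ℤ) := by norm_num
      rw [h77, dvd_neg] at h
      exact h
    have hp7' : p ∣ 7 := by exact_mod_cast h7
    exact hp7 ((Nat.prime_dvd_prime_iff_eq hp.out (by norm_num)).mp hp7')
  have htower : ∀ k : ℕ, ((⟨0, 1, 1, -4, 2⟩ : WeierstrassCurve ℤ).map (Int.castRingHom ℚ)).HasSurjectiveModNGaloisRep (p ^ k : ℕ) :=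
    serre_hasSurjectiveModNGaloisRep_pow_holds ((⟨0, 1, 1, -4, 2⟩ : WeierstrassCurve ℤ).map (Int.castRingHom ℚ)) p h5 hsurj
  have hC : (⟨1, (-2 : ℚ), (0 : ℚ), -((1 : ℚ) / 2)⟩ : WeierstrassCurve.VariableChange ℚ) •
      ((⟨0, -1, 1, -212, -1184⟩ : WeierstrassCurve ℤ).map (Int.castRingHom ℚ)) =
      ((⟨0, 1, 1, -4, 2⟩ : WeierstrassCurve ℤ).map (Int.castRingHom ℚ)).quadraticTwist (NumberField.discr K : ℚ) := by
    rw [hD]; push_cast; exact minTwist7_smul_eq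
  have hrank : 2 ≤ ((⟨0, 1, 1, -4, 2⟩ : WeierstrassCurve ℤ).map (Int.castRingHom ℚ)).mordellWeilRank := KernelCerts001.C571b1.two_le_rank
  have hν' : n.primeFactors.card ≤ ((⟨0, 1, 1, -4, 2⟩ : WeierstrassCurve ℤ).map (Int.castRingHom ℚ)).mordellWeilRank := le_trans hν hrank
  have hμ' : m.primeFactors.card ≤ ((⟨0, 1, 1, -4, 2⟩ : WeierstrassCurve ℤ).map (Int.castRingHom ℚ)).mordellWeilRank := le_trans hμ hrank
  exact cruxBody_of_kuriharaClaims_spade hKim hnf hMaz h84 ((⟨0, 1, 1, -4, 2⟩ : WeierstrassCurve ℤ).map (Int.castRingHom ℚ)) hrank p h5 hgood hord htower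
    (kodairaNeron_of_five_le p h5) hna hsp.1 hS2 K hK hD3 hD4 hpD hH n hn hν' hδE
    ((⟨0, -1, 1, -212, -1184⟩ : WeierstrassCurve ℤ).map (Int.castRingHom ℚ)) _ hC hTna
    hTKN m hm hμ' hδT


/-! ## Kernel point counts (`countPointsFast`) -/

/-- `#Ẽ(𝔽₁₃) = 19` for `571b1` (`a_13 = −5`: good ordinary, non-anomalous). [cite: CremonaAlgorithms1997, Table 1 (571b1)] -/
theorem card_13 :
    Nat.card (((⟨0, 1, 1, -4, 2⟩ : WeierstrassCurve ℤ).map (Int.castRingHom (ZMod 13))).toAffine.Point) = 19 :=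
  haveI : Fact (Nat.Prime 13) := ⟨by norm_num⟩
  natCard_point_eq_of_countPoints 0 1 1 (-4) 2 13 (by norm_num) (by decide +kernel) (n := 19)
    (countPoints_eq_of_fast (by decide +kernel))

/-- `#Ẽ(𝔽₂₁₁₃) = 2068 = 11·188` (`2113 ≡ 1`, `a = 46 ≡ 2 (mod 11)`; `121 ∤`). [cite: CremonaAlgorithms1997, Table 1 (571b1)] -/
theorem card_2113 :
    Nat.card (((⟨0, 1, 1, -4, 2⟩ : WeierstrassCurve ℤ).map (Int.castRingHom (ZMod 2113))).toAffine.Point) = 2068 :=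
  haveI : Fact (Nat.Prime 2113) := ⟨by norm_num⟩
  natCard_point_eq_of_countPoints 0 1 1 (-4) 2 2113 (by norm_num) (by decide +kernel) (n := 2068)
    (countPoints_eq_of_fast (by decide +kernel))

/-- `#Ẽ(𝔽₄₁₅₉) = 4246 = 11·386` (`4159 ≡ 1`, `a = −86 ≡ 2 (mod 11)`; `121 ∤`). [cite: CremonaAlgorithms1997, Table 1 (571b1)] -/
theorem card_4159 :
    Nat.card (((⟨0, 1, 1, -4, 2⟩ : WeierstrassCurve ℤ).map (Int.castRingHom (ZMod 4159))).toAffine.Point) = 4246 :=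
  haveI : Fact (Nat.Prime 4159) := ⟨by norm_num⟩
  natCard_point_eq_of_countPoints 0 1 1 (-4) 2 4159 (by norm_num) (by decide +kernel) (n := 4246)
    (countPoints_eq_of_fast (by decide +kernel))

/-- `#Ẽ(𝔽₅₃) = 52 = 13·4` (`53 ≡ 1`, `a = 2 (mod 13)`; `169 ∤`). [cite: CremonaAlgorithms1997, Table 1 (571b1)] -/
theorem card_53 :
    Nat.card (((⟨0, 1, 1, -4, 2⟩ : WeierstrassCurve ℤ).map (Int.castRingHom (ZMod 53))).toAffine.Point) = 52 :=
  haveI : Fact (Nat.Prime 53) := ⟨by norm_num⟩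
  natCard_point_eq_of_countPoints 0 1 1 (-4) 2 53 (by norm_num) (by decide +kernel) (n := 52)
    (countPoints_eq_of_fast (by decide +kernel))

/-- `#Ẽ(𝔽₁₈₄₇) = 1872 = 13·144` (`1847 ≡ 1`, `a = −24 ≡ 2 (mod 13)`; `169 ∤`). [cite: CremonaAlgorithms1997, Table 1 (571b1)] -/
theorem card_1847 :
    Nat.card (((⟨0, 1, 1, -4, 2⟩ : WeierstrassCurve ℤ).map (Int.castRingHom (ZMod 1847))).toAffine.Point) = 1872 :=
  haveI : Fact (Nat.Prime 1847) := ⟨by norm_num⟩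
  natCard_point_eq_of_countPoints 0 1 1 (-4) 2 1847 (by norm_num) (by decide +kernel) (n := 1872)
    (countPoints_eq_of_fast (by decide +kernel))

/-- `#T̃₀(𝔽₁₃) = 9` (`a_13(T₀) = 5`: non-anomalous at `13`). [cite: CremonaAlgorithms1997, Table 1 (571b1)] -/
theorem minTwist7_card_13 :
    Nat.card (((⟨0, -1, 1, -212, -1184⟩ : WeierstrassCurve ℤ).map (Int.castRingHom (ZMod 13))).toAffine.Point) = 9 :=
  haveI : Fact (Nat.Prime 13) := ⟨by norm_num⟩
  natCard_point_eq_of_countPoints 0 (-1) 1 (-212) (-1184) 13 (by norm_num) (by decide +kernel) (n := 9)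
    (countPoints_eq_of_fast (by decide +kernel))

/-- `#T̃₀(𝔽₁₀₁₃) = 1023 = 11·93` (`1013 ≡ 1`, `a = −9 ≡ 2 (mod 11)`; `121 ∤`). [cite: CremonaAlgorithms1997, Table 1 (571b1)] -/
theorem minTwist7_card_1013 :
    Nat.card (((⟨0, -1, 1, -212, -1184⟩ : WeierstrassCurve ℤ).map (Int.castRingHom (ZMod 1013))).toAffine.Point) = 1023 :=
  haveI : Fact (Nat.Prime 1013) := ⟨by norm_num⟩
  natCard_point_eq_of_countPoints 0 (-1) 1 (-212) (-1184) 1013 (by norm_num) (by decide +kernel) (n := 1023)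
    (countPoints_eq_of_fast (by decide +kernel))

/-- `#T̃₀(𝔽₅₃) = 52 = 13·4` (`53 ≡ 1`, `a = 2 (mod 13)`; `169 ∤`). [cite: CremonaAlgorithms1997, Table 1 (571b1)] -/
theorem minTwist7_card_53 :
    Nat.card (((⟨0, -1, 1, -212, -1184⟩ : WeierstrassCurve ℤ).map (Int.castRingHom (ZMod 53))).toAffine.Point) = 52 :=
  haveI : Fact (Nat.Prime 53) := ⟨by norm_num⟩
  natCard_point_eq_of_countPoints 0 (-1) 1 (-212) (-1184) 53 (by norm_num) (by decide +kernel) (n := 52)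
    (countPoints_eq_of_fast (by decide +kernel))


/-! ## `p = 11`: admissibility, the E-level `2113·4159`, the twist level `1013` -/

/-- **`11` is good ordinary for `571b1`** (`11 ∤ 571`, `a_11 = -3`). [cite: CremonaAlgorithms1997, Table 1 (571b1)] -/
theorem goodOrdinary_11 :
    haveI := Fact.mk (by norm_num : Nat.Prime 11); haveI := isGloballyMinimal_c571b1;
    ((⟨0, 1, 1, -4, 2⟩ : WeierstrassCurve ℤ).map (Int.castRingHom ℚ)).HasGoodReductionAtPrime 11 ∧ ¬ ((11 : ℕ) : ℤ) ∣ ((⟨0, 1, 1, -4, 2⟩ : WeierstrassCurve ℤ).map (Int.castRingHom ℚ)).frobeniusTrace 11 := by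
  haveI := Fact.mk (by norm_num : Nat.Prime 11)
  haveI := isElliptic_c571b1; haveI := isGloballyMinimal_c571b1
  exact goodOrdinary_of_intModel_certificate intModel 11 (by decide +kernel) (n := 15) card_11 (by decide +kernel)

/-- **`ρ̄_{E,11}` is surjective for `571b1`**: semistable and `X² − a_5X + 5` (`a_5 = -2`) has no root mod `11` (Mazur Prop. 6.3 (1), Serre
Prop. 21). [cite: Serre1972, §5.4 Prop. 21] [cite: Mazur1978, §6 Prop. 6.3 (1)] -/
theorem hasSurjectiveModNGaloisRep_11 :
    haveI := isElliptic_c571b1; ((⟨0, 1, 1, -4, 2⟩ : WeierstrassCurve ℤ).map (Int.castRingHom ℚ)).HasSurjectiveModNGaloisRep (11 : ℕ) := by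
  have hn : ∀ t : ZMod 11, t ^ 2 - (((5 : ℕ) : ℤ) + 1 - (8 : ℕ) : ℤ) * t + ((5 : ℕ) : ZMod 11) ≠ 0 := by
    decide +kernel
  haveI := Fact.mk (by norm_num : Nat.Prime 11); haveI := Fact.mk (by norm_num : Nat.Prime 5)
  haveI := isElliptic_c571b1; haveI := isGloballyMinimal_c571b1
  exact hasSurjectiveModNGaloisRep_of_intModel_certificate intModel
    (by rw [Int.isCoprime_iff_gcd_eq_one]; decide +kernel) 11 5 (by norm_num) (by decide +kernel)
    (n := 8) card_5 hn

/-- **`11` is non-anomalous for `571b1`** (`a_11 − 1 = -4`) and for `T₀` (`a_11(T₀) − 1 = -4`). [cite: SilvermanAEC2009, VII.3 Prop. 3.1] -/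
theorem nonAnomalous_11 :
    haveI := isGloballyMinimal_c571b1; haveI := minTwist7_isGloballyMinimal; haveI := Fact.mk (by norm_num : Nat.Prime 11);
    ¬ ((11 : ℕ) : ℤ) ∣ ((⟨0, 1, 1, -4, 2⟩ : WeierstrassCurve ℤ).map (Int.castRingHom ℚ)).frobeniusTrace 11 - 1 ∧ ¬ ((11 : ℕ) : ℤ) ∣ ((⟨0, -1, 1, -212, -1184⟩ : WeierstrassCurve ℤ).map (Int.castRingHom ℚ)).frobeniusTrace 11 - 1 := by
  haveI := isElliptic_c571b1; haveI := isGloballyMinimal_c571b1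
  haveI := minTwist7_isElliptic; haveI := minTwist7_isGloballyMinimal
  haveI := Fact.mk (by norm_num : Nat.Prime 11)
  rw [IntModel.frobeniusTrace_eq intModel card_11, IntModel.frobeniusTrace_eq minTwist7_intModel minTwist7_card_11]
  decide

/-- **`8787967 = 2113·4159` is a cyclic Kolyvagin level for `(571b1, 11)`** — the level of `cert_571b1` at `p = 11`. [cite: Kim2022StructureSelmer, §1.2.2 (PDF p. 5)] -/
theorem isCyclicKolyvaginLevel_11_8787967 :
    haveI := isGloballyMinimal_c571b1; haveI := Fact.mk (by norm_num : Nat.Prime 11);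
    IsCyclicKolyvaginLevel ((⟨0, 1, 1, -4, 2⟩ : WeierstrassCurve ℤ).map (Int.castRingHom ℚ)) 11 8787967 := by
  haveI := isElliptic_c571b1; haveI := isGloballyMinimal_c571b1
  haveI := Fact.mk (by norm_num : Nat.Prime 11)
  haveI : Fact (Nat.Prime 2113) := ⟨by norm_num⟩
  haveI : Fact (Nat.Prime 4159) := ⟨by norm_num⟩
  have h₁ : Kato.IsKolyvaginPrime ((⟨0, 1, 1, -4, 2⟩ : WeierstrassCurve ℤ).map (Int.castRingHom ℚ)) 11 1 2113 :=
    isKolyvaginPrime_of_intModel_of_card intModel 11 1 2113 (by norm_num) (by decide +kernel) (by decide) card_2113 (by norm_num)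
  have h₂ : Kato.IsKolyvaginPrime ((⟨0, 1, 1, -4, 2⟩ : WeierstrassCurve ℤ).map (Int.castRingHom ℚ)) 11 1 4159 :=
    isKolyvaginPrime_of_intModel_of_card intModel 11 1 4159 (by norm_num) (by decide +kernel) (by decide) card_4159 (by norm_num)
  refine ⟨by simpa using isKolyvaginProduct_mul h₁ h₂ (by norm_num), fun ℓ hℓ hdvd ↦ ?_⟩
  rw [show (8787967 : ℕ) = 2113 * 4159 from rfl] at hdvd
  rcases (Nat.Prime.dvd_mul hℓ.out).mp hdvd with h | h
  · obtain rfl := (Nat.prime_dvd_prime_iff_eq hℓ.out (by norm_num)).mp h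
    exact card_torsion_le_of_intModel_of_card intModel 11 2113 card_2113 (by norm_num)
  · obtain rfl := (Nat.prime_dvd_prime_iff_eq hℓ.out (by norm_num)).mp h
    exact card_torsion_le_of_intModel_of_card intModel 11 4159 card_4159 (by norm_num)

/-- **`1013` is a cyclic Kolyvagin level for `(T₀, 11)`** — the level of `cert_27979d1` at `p = 11`. [cite: Kim2022StructureSelmer, §1.2.2 (PDF p. 5)] -/
theorem minTwist7_isCyclicKolyvaginLevel_11_1013 :
    haveI := minTwist7_isGloballyMinimal; haveI := Fact.mk (by norm_num : Nat.Prime 11);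
    IsCyclicKolyvaginLevel ((⟨0, -1, 1, -212, -1184⟩ : WeierstrassCurve ℤ).map (Int.castRingHom ℚ)) 11 1013 := by
  haveI := minTwist7_isElliptic; haveI := minTwist7_isGloballyMinimal
  haveI := Fact.mk (by norm_num : Nat.Prime 11)
  haveI : Fact (Nat.Prime 1013) := ⟨by norm_num⟩
  have h : Kato.IsKolyvaginPrime ((⟨0, -1, 1, -212, -1184⟩ : WeierstrassCurve ℤ).map (Int.castRingHom ℚ)) 11 1 1013 :=
    isKolyvaginPrime_of_intModel_of_card minTwist7_intModel 11 1 1013 (by norm_num) (by decide +kernel) (by decide)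
      minTwist7_card_1013 (by norm_num)
  refine ⟨⟨Nat.squarefree_iff_nodup_primeFactorsList (by norm_num) |>.mpr (by simp), fun ℓ hℓ ↦ ?_⟩, fun ℓ hℓ hdvd ↦ ?_⟩
  · rw [show (1013 : ℕ).primeFactors = {1013} from (Nat.Prime.primeFactors (by norm_num)), Finset.mem_singleton] at hℓ
    exact hℓ ▸ h
  · obtain rfl := (Nat.prime_dvd_prime_iff_eq hℓ.out (by norm_num)).mp hdvd
    exact card_torsion_le_of_intModel_of_card minTwist7_intModel 11 1013 minTwist7_card_1013 (by norm_num)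

/-- **Kodaira–Néron for `T₀` at `11`**: `|Δ(T₀)| = 7⁶·571 < 6^11` and no prime `< 6` divides it, so every multiplicative place has
exponent `< 11` (table lemma, vacuous table). [cite: SilvermanAEC2009, VII.5.1, VIII.8] -/
theorem minTwist7_kodairaNeron_11 :
    haveI := minTwist7_isElliptic; haveI := minTwist7_isGloballyMinimal;
    ∀ v : HeightOneSpectrum (𝓞 ℚ), ((⟨0, -1, 1, -212, -1184⟩ : WeierstrassCurve ℤ).map (Int.castRingHom ℚ)).HasMultiplicativeReductionAt v → ¬ 11 ∣ ((⟨0, -1, 1, -212, -1184⟩ : WeierstrassCurve ℤ).map (Int.castRingHom ℚ)).ordMinimalDiscriminant v := by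
  haveI := minTwist7_isElliptic; haveI := minTwist7_isGloballyMinimal
  refine not_dvd_ordMinimalDiscriminant_of_intModel_table minTwist7_intModel (p := 11) (Δ₀ := (-67177579))
    (by decide +kernel) (B := 6) (by decide +kernel) ?_
  intro q hq hqP hqd
  exfalso
  have hqB : q < 6 := Finset.mem_range.mp hq
  interval_cases q <;> first | (norm_num at hqP; done) | exact absurd hqd (by decide)

/-- **DEPTH-TABLE ROW `571b1`, `(p, d_K) = (11, −7)`, v17** — the clause of `KolyvaginDepthSupplyKN` at `571b1` with witness prime `11`
(SPLIT in `ℚ(√−7)`), from the CLAIMS of `cert_571b1` @ `(11, 2113·4159)` and `cert_27979d1` @ `(11, 1013)`, CONDITIONAL on Kim Thm. 1.11,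
modularity, Mazur Cor. 4.1, W. Zhang L8.4 (1)/9.1 BY NAME; per curve; BSD is not proved by it.
[cite: Kim2022StructureSelmer, Thm. 1.11 (PDF p. 8)] [cite: WZhang2014, Lemma 8.4 (1) (p. 236), Thm. 9.1 (p. 240)] [cite: Mazur1978, Cor. 4.1] -/
theorem cruxBody_of_kuriharaClaims_11_neg7
    (hKim : Kim2022_card_selmerGroup_le_pow_of_kuriharaNumber_ne_zero)
    (hnf : exists_isNewformOf) (hMaz : mazur_not_dvd_maninConstant_of_odd)
    (h84 : Literature.NumberTheory.EllipticCurves.WZhang2014_lemma84_exists_minimal_kolyvaginClass_one_selmerCard)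
    (K : Type) [Field K] [NumberField K] (hK : IsImaginaryQuadratic K) (hD : NumberField.discr K = -7)
    (hδE : haveI := isElliptic_c571b1; haveI := isGloballyMinimal_c571b1;
      haveI : NeZero (((⟨0, 1, 1, -4, 2⟩ : WeierstrassCurve ℤ).map (Int.castRingHom ℚ)).conductorNorm ℤ) := neZero_conductorNorm_of_isElliptic _;
      haveI := Fact.mk (by norm_num : Nat.Prime 11);
      ∀ (D : ModularParametrizationData ((⟨0, 1, 1, -4, 2⟩ : WeierstrassCurve ℤ).map (Int.castRingHom ℚ)) (((⟨0, 1, 1, -4, 2⟩ : WeierstrassCurve ℤ).map (Int.castRingHom ℚ)).conductorNorm ℤ)), ¬ ((11 : ℕ) : ℤ) ∣ D.maninConstant →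
        (∃ u : ℚ, ‖(u : ℚ_[11])‖ = 1 ∧ ((⟨0, 1, 1, -4, 2⟩ : WeierstrassCurve ℤ).map (Int.castRingHom ℚ)).realPeriodRat = u * plusPeriod D.f) →
        ∃ ψ : (ℓ : ℕ) → (ZMod ℓ)ˣ →* Multiplicative (ZMod 11),
          (∀ ℓ ∈ (8787967 : ℕ).primeFactors, Function.Surjective (ψ ℓ)) ∧ kuriharaNumber D.f 11 8787967 ψ ≠ 0)
    (hδT : haveI := minTwist7_isElliptic; haveI := minTwist7_isGloballyMinimal;
      haveI : NeZero (((⟨0, -1, 1, -212, -1184⟩ : WeierstrassCurve ℤ).map (Int.castRingHom ℚ)).conductorNorm ℤ) := neZero_conductorNorm_of_isElliptic _;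
      haveI := Fact.mk (by norm_num : Nat.Prime 11);
      ∀ (D : ModularParametrizationData ((⟨0, -1, 1, -212, -1184⟩ : WeierstrassCurve ℤ).map (Int.castRingHom ℚ)) (((⟨0, -1, 1, -212, -1184⟩ : WeierstrassCurve ℤ).map (Int.castRingHom ℚ)).conductorNorm ℤ)), ¬ ((11 : ℕ) : ℤ) ∣ D.maninConstant →
        (∃ u : ℚ, ‖(u : ℚ_[11])‖ = 1 ∧ ((⟨0, -1, 1, -212, -1184⟩ : WeierstrassCurve ℤ).map (Int.castRingHom ℚ)).realPeriodRat = u * plusPeriod D.f) →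
        ∃ ψ : (ℓ : ℕ) → (ZMod ℓ)ˣ →* Multiplicative (ZMod 11),
          (∀ ℓ ∈ (1013 : ℕ).primeFactors, Function.Surjective (ψ ℓ)) ∧ kuriharaNumber D.f 11 1013 ψ ≠ 0) :
    haveI := isElliptic_c571b1; haveI := isGloballyMinimal_c571b1;
    ∃ (p : ℕ) (hp : Fact p.Prime), 5 ≤ p ∧ ((⟨0, 1, 1, -4, 2⟩ : WeierstrassCurve ℤ).map (Int.castRingHom ℚ)).HasGoodReductionAtPrime p ∧
      ¬ (p : ℤ) ∣ ((⟨0, 1, 1, -4, 2⟩ : WeierstrassCurve ℤ).map (Int.castRingHom ℚ)).frobeniusTrace p ∧ (∀ n : ℕ, ((⟨0, 1, 1, -4, 2⟩ : WeierstrassCurve ℤ).map (Int.castRingHom ℚ)).HasSurjectiveModNGaloisRep (p ^ n : ℕ)) ∧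
      (∀ v : HeightOneSpectrum (𝓞 ℚ), ((⟨0, 1, 1, -4, 2⟩ : WeierstrassCurve ℤ).map (Int.castRingHom ℚ)).HasMultiplicativeReductionAt v → ¬ p ∣ ((⟨0, 1, 1, -4, 2⟩ : WeierstrassCurve ℤ).map (Int.castRingHom ℚ)).ordMinimalDiscriminant v) ∧
      ∃ (K : Type) (_ : Field K) (_ : NumberField K), IsImaginaryQuadratic K ∧
        NumberField.discr K ≠ -3 ∧ NumberField.discr K ≠ -4 ∧
        ∃ (_ : NeZero (((⟨0, 1, 1, -4, 2⟩ : WeierstrassCurve ℤ).map (Int.castRingHom ℚ)).conductorNorm ℤ)), SatisfiesHeegnerHypothesis (((⟨0, 1, 1, -4, 2⟩ : WeierstrassCurve ℤ).map (Int.castRingHom ℚ)).conductorNorm ℤ) K ∧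
        ∃ (Dt : ModularParametrizationData ((⟨0, 1, 1, -4, 2⟩ : WeierstrassCurve ℤ).map (Int.castRingHom ℚ)) (((⟨0, 1, 1, -4, 2⟩ : WeierstrassCurve ℤ).map (Int.castRingHom ℚ)).conductorNorm ℤ)) (β : ℤ) (ι : K →+* ℂ) (n₁ : ℕ)
          (d : KolyvaginHeegnerData Dt β ι n₁), Squarefree n₁ ∧
          (∀ q ∈ n₁.primeFactors, Zhang2014.IsKolyvaginPrime (((⟨0, 1, 1, -4, 2⟩ : WeierstrassCurve ℤ).map (Int.castRingHom ℚ)).conductorNorm ℤ) ((⟨0, 1, 1, -4, 2⟩ : WeierstrassCurve ℤ).map (Int.castRingHom ℚ)) K p q) ∧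
          d.kolyvaginClass hp.out 1 ≠ 0 ∧
          (n₁.primeFactors.card + 1 ≤ ((⟨0, 1, 1, -4, 2⟩ : WeierstrassCurve ℤ).map (Int.castRingHom ℚ)).mordellWeilRank ∨
            (n₁.primeFactors.card ≤ ((⟨0, 1, 1, -4, 2⟩ : WeierstrassCurve ℤ).map (Int.castRingHom ℚ)).mordellWeilRank ∧
              n₁.primeFactors.card + 1 ≤ (((⟨0, 1, 1, -4, 2⟩ : WeierstrassCurve ℤ).map (Int.castRingHom ℚ)).quadraticTwist (NumberField.discr K : ℚ)).mordellWeilRank)) := by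
  haveI := isElliptic_c571b1; haveI := isGloballyMinimal_c571b1
  haveI iP := Fact.mk (by norm_num : Nat.Prime 11)
  haveI : NeZero (8787967 : ℕ) := ⟨by norm_num⟩
  haveI : NeZero (1013 : ℕ) := ⟨by norm_num⟩
  have hν : (8787967 : ℕ).primeFactors.card ≤ 2 := by
    rw [show (8787967 : ℕ) = 2113 * 4159 from rfl, Nat.primeFactors_mul (by norm_num) (by norm_num),
      Nat.Prime.primeFactors (by norm_num), Nat.Prime.primeFactors (by norm_num)]
    decide
  have hμ : (1013 : ℕ).primeFactors.card ≤ 2 := by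
    rw [Nat.Prime.primeFactors (by norm_num), Finset.card_singleton]; omega
  exact cruxBody_of_kuriharaClaims_neg7_at hKim hnf hMaz h84 11 (by norm_num) (by norm_num) goodOrdinary_11.1 goodOrdinary_11.2
    hasSurjectiveModNGaloisRep_11 nonAnomalous_11.1 K hK hD 8787967 isCyclicKolyvaginLevel_11_8787967 hν hδE
    nonAnomalous_11.2 minTwist7_kodairaNeron_11 1013 minTwist7_isCyclicKolyvaginLevel_11_1013 hμ hδT


end C571b1

end Summit.BirchSwinnertonDyer.BirchSwinnertonDyer.Theorems.KolyvaginDepthDoor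

end
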